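import Literature.NumberTheory.EllipticCurves.ComplexMultiplicationCoatesWiles
import Literature.NumberTheory.EllipticCurves.CongruentNumberCurveJacobiSums
import Mathlib.AlgebraicGeometry.EllipticCurve.NormalForms
import Mathlib.NumberTheory.SumTwoSquares
import HarnessLib

/-!
# Deuring's `a_p = π + π̄` for `j = 1728` (Gauss; Ireland–Rosen, Ch. 18 §4 Thm. 5), proved

Sibling proof file of `Literature.NumberTheory.EllipticCurves.ComplexMultiplicationCoatesWiles`
(D-0014 append protocol; everything here is proved). It establishes the case `j(E) = 1728`
(`K = ℚ(i)`, `d = -4`, `𝓞_K = ℤ[i]`) of the named fact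
`Literature.NumberTheory.EllipticCurves.Deuring1941_frobeniusTrace_eq_add_conj` (Deuring 1941; Cox, *Primes of the form
x² + ny²*, Thm. 14.16: at a good prime `p` split in `K`, `a_p(E) = π + π̄` with `π ∈ 𝓞_K`,
`ππ̄ = p`) unconditionally:

* `Literature.NumberTheory.EllipticCurves.Deuring1941_frobeniusTrace_eq_add_conj_of_j_eq` — for a globally minimal `W/ℚ` with
  `j(W) = 1728` and a prime `p ∤ 2 Δ_W` with `-4` a square mod `p`, there is `π ∈ ℤ[i] ⊂ ℂ`
  (`cmRing (-4)`) with `ππ̄ = p` and `a_p(W) = π + π̄` — literally the body of the named fact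
  under `W.j = 1728`.

Cox himself points out (§14.C, PDF pp. 323–324, (14.17) and the paragraph after it, Exercises
14.13–14.14) that for `j = 0` and `j = 1728` Deuring's theorem is Gauss's count of points on
`x³ = y³ + 1` and on `x² + y² + x²y² = 1` (the lemniscate curve, `≅ y² = 4x³ + x`). The proof
here is that remark made precise with the tree's theorem
`Literature.NumberTheory.EllipticCurves.IrelandRosen1990_card_points_one_mod_four_holds` (Ireland–Rosen, *A Classical Introduction
to Modern Number Theory*, Ch. 18 §4 Thm. 5, proved in
`Literature.NumberTheory.EllipticCurves.CongruentNumberCurveJacobiSums` by Jacobi sums of the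
quartic character): for `p ≡ 1 (4)`, `p ∤ D`, `p = ππ̄` with `π ≡ 1 (2 + 2i)`,
`#E_D(𝔽_p) = p + 1 − \overline{χ_π(D)} π − χ_π(D) π̄` for `E_D : y² = x³ − Dx`, where
`χ_π(D) ∈ {±1, ±i}`; hence `a_p = π' + π̄'` with `π' = \overline{χ_π(D)} π ∈ ℤ[i]`, `π'π̄' = p`.

## Proof

Let `W/ℚ` be globally minimal with `j(W) = 1728`, `p` an odd prime with `p ∤ Δ_W` and `-4` a
square mod `p`. Then `-1` is a square mod `p`, so `p ≡ 1 (mod 4)` (`ZMod.mod_four_ne_three_of_sq_eq_neg_sq'`)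
and `p ≥ 5`. The reduction `Ẽ = W mod p` is an elliptic curve over `𝔽_p` with
`c₄(Ẽ)³ = 1728 Δ(Ẽ)` (reduce the integral identity `c₄³ = j Δ = 1728 Δ` of the minimal model), i.e.
`j(Ẽ) = 1728`. As `6` is invertible in `𝔽_p`, Mathlib's `toShortNF` puts `Ẽ` in short
Weierstrass form `E' : y² = x³ + a₄x + a₆` over `𝔽_p` (`𝔽_p`-isomorphic, so with the same number
of `𝔽_p`-points, the tree's `VariableChange.pointEquiv`), and `j(E') = 6912a₄³/(4a₄³ + 27a₆²) = 1728`
forces `a₆ = 0`: `E' = E_D` with `D ≡ -a₄`, `p ∤ D`. Write `p = a² + b²` (Fermat, Mathlib's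
`Nat.Prime.sq_add_sq`), let `π` be the primary associate of `a + bi` (the tree's
`GaussianPrimary.primary`), and `χ_π(D) = i^k` (the tree's quartic character `GaussianQuartic.chi`,
a unit, with `π ∣ D^{(p-1)/4} − i^k` by its defining property). Ireland–Rosen 18.5 gives
`#Ẽ(𝔽_p) = #E_D(𝔽_p) = p + 1 − 2 Re(ī^k π)`, so `a_p(W) = p + 1 − #Ẽ(𝔽_p) = π' + π̄'` for
`π' = ī^k π`, `N(π') = N(π) = p`; finally `ℤ[i] = ℤ[ω_{-4}]` (`ω_{-4} = (-4 + √-4)/2 = -2 + i`) is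
`cmRing (-4) = cmRing (cmDiscr 1728)`.

## References

* K. Ireland, M. Rosen, *A Classical Introduction to Modern Number Theory*, 2nd ed., GTM 84
  (1990), Ch. 18 §4 Thm. 5 (PDF p. 301). [IrelandRosen1990]
* D. A. Cox, *Primes of the form x² + ny²*, 2nd ed. (2013), §14.C: Thm. 14.16, (14.17) and the
  discussion following it, Exercises 14.13–14.14 (PDF pp. 322–324, 337). [Cox2013]
* M. Deuring, Abh. Math. Sem. Univ. Hamburg 14 (1941), 197–272. [Deuring1941]
-/

noncomputable section

open scoped Classical ComplexConjugate

open WeierstrassCurve Complex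

namespace Literature.NumberTheory.EllipticCurves

/-! ### Elementary lemmas -/

/-- If `-4` is a square modulo an odd prime `p`, then `p ≡ 1 (mod 4)`. [folklore] -/
theorem mod_four_eq_one_of_isSquare_neg_four {p : ℕ} [Fact p.Prime] (h2 : p ≠ 2)
    (h : IsSquare ((-4 : ℤ) : ZMod p)) : p % 4 = 1 := by
  obtain ⟨r, hr⟩ := h
  have h2' : (2 : ZMod p) ≠ 0 := by
    intro h0
    have h0' : ((2 : ℕ) : ZMod p) = 0 := by exact_mod_cast h0
    rw [ZMod.natCast_eq_zero_iff] at h0'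
    exact h2 ((Nat.prime_dvd_prime_iff_eq (Fact.out) Nat.prime_two).mp h0')
  have hsq : r ^ 2 = -(2 : ZMod p) ^ 2 := by
    rw [sq, ← hr]; push_cast; ring
  have h3 := ZMod.mod_four_ne_three_of_sq_eq_neg_sq' h2' hsq
  rcases (Fact.out : p.Prime).eq_two_or_odd with h | hodd
  · exact absurd h h2
  · omega

/-- `c₄³ = 1728 Δ` for the minimal model of a curve with `j = 1728`. [folklore] -/
theorem c₄_pow_three_eq_of_j_eq (W : WeierstrassCurve ℚ) [W.IsElliptic] [W.IsGloballyMinimal]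
    (hj : W.j = 1728) : (integralModelInt W).c₄ ^ 3 = 1728 * (integralModelInt W).Δ := by
  have hc : ((integralModelInt W).c₄ : ℚ) = W.c₄ := by
    have h := (integralModelInt W).map_c₄ (Int.castRingHom ℚ)
    rw [map_integralModelInt, eq_intCast] at h
    exact h.symm
  have hΔ : ((integralModelInt W).Δ : ℚ) = W.Δ := cast_minimalDiscriminantInt W
  have key : W.c₄ ^ 3 = 1728 * W.Δ := by
    have hΔ0 : W.Δ ≠ 0 := W.Δ'.ne_zero
    have : W.j * W.Δ = W.c₄ ^ 3 := by
      rw [j, Units.val_inv_eq_inv_val, coe_Δ', inv_mul_eq_div, div_mul_cancel₀ _ hΔ0]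
    rw [← this, hj]
  exact_mod_cast (show ((integralModelInt W).c₄ : ℚ) ^ 3 = 1728 * ((integralModelInt W).Δ : ℚ) by
    rw [hc, hΔ, key])

/-- A short Weierstrass curve `y² = x³ + a₄x + a₆` with `j = 1728` over a field with `6 ≠ 0` has
`a₆ = 0`. [folklore] -/
theorem a₆_eq_zero_of_j_eq {F : Type*} [Field F] (E : WeierstrassCurve F) [E.IsElliptic]
    [E.IsShortNF] (h2 : (2 : F) ≠ 0) (h3 : (3 : F) ≠ 0) (hj : E.j = 1728) : E.a₆ = 0 := by
  have hden : 4 * E.a₄ ^ 3 + 27 * E.a₆ ^ 2 ≠ 0 := by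
    intro h0
    have hΔ : E.Δ = 0 := by rw [E.Δ_of_isShortNF, h0, mul_zero]
    exact E.Δ'.ne_zero (by rw [coe_Δ']; exact hΔ)
  rw [E.j_of_isShortNF, div_eq_iff hden] at hj
  have h6 : (46656 : F) * E.a₆ ^ 2 = 0 := by linear_combination (-1 : F) * hj
  have h46656 : (46656 : F) ≠ 0 := by
    rw [show (46656 : F) = 2 ^ 6 * 3 ^ 6 by norm_num]
    exact mul_ne_zero (pow_ne_zero _ h2) (pow_ne_zero _ h3)
  simpa [h46656] using h6

/-- `GaussianInt ⊆ ℤ[ω_{-4}]` inside `ℂ` (`ω_{-4} = (-4 + √-4)/2 = -2 + i`, so `x + yi = (x + 2y) + y ω_{-4}`).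
[folklore] -/
theorem toComplex_mem_cmRing_neg_four (x : GaussianInt) : (x : ℂ) ∈ cmRing (-4) := by
  have hs : Real.sqrt (-((-4 : ℤ) : ℝ)) = 2 := by
    rw [show (-((-4 : ℤ) : ℝ)) = 2 ^ 2 by norm_num, Real.sqrt_sq (by norm_num)]
  have hgen : cmGen (-4) = -2 + I := by
    rw [cmGen, hs]; push_cast; ring
  rw [mem_cmRing_iff (d := -4) (c := 5) (by norm_num) (by norm_num)]
  refine ⟨x.re + 2 * x.im, x.im, ?_⟩
  rw [GaussianInt.toComplex_def, hgen]
  push_cast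
  ring

/-! ### The reduction of a `j = 1728` curve is `y² = x³ - Dx` over `𝔽_p` -/

/-- For a globally minimal `W/ℚ` with `j(W) = 1728` and a prime `p ≥ 5` of good reduction, the
reduction of `W` modulo `p` is `𝔽_p`-isomorphic to `y² = x³ - Dx` for some `D ∈ ℤ`, `p ∤ D`; in
particular they have the same number of `𝔽_p`-points. [folklore] -/
theorem exists_natCard_reduction_eq_of_j_eq (W : WeierstrassCurve ℚ) [W.IsElliptic]
    [W.IsGloballyMinimal] (hj : W.j = 1728) {p : ℕ} [Fact p.Prime] (h2 : (2 : ZMod p) ≠ 0)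
    (h3 : (3 : ZMod p) ≠ 0) (hΔ : ¬ (p : ℤ) ∣ minimalDiscriminantInt W) :
    ∃ D : ℤ, ¬ (p : ℤ) ∣ D ∧
      reductionPointCount W p =
        Nat.card (⟨0, 0, 0, -(D : ZMod p), 0⟩ : WeierstrassCurve (ZMod p)).toAffine.Point := by
  set E : WeierstrassCurve (ZMod p) := (integralModelInt W).map (Int.castRingHom (ZMod p)) with hE
  have hEΔ : E.Δ = ((minimalDiscriminantInt W : ℤ) : ZMod p) := by
    rw [hE, map_Δ, eq_intCast]; rfl
  have hΔ0 : E.Δ ≠ 0 := by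
    rwa [hEΔ, Ne, ZMod.intCast_zmod_eq_zero_iff_dvd]
  haveI : E.IsElliptic := by rw [isElliptic_iff, isUnit_iff_ne_zero]; exact hΔ0
  -- `j(E) = 1728`
  have hc4 : E.c₄ ^ 3 = E.Δ * 1728 := by
    have h := congrArg (Int.castRingHom (ZMod p)) (c₄_pow_three_eq_of_j_eq W hj)
    rw [map_pow, map_mul] at h
    rw [hE, map_c₄, map_Δ, h, mul_comm]
    simp
  have hjE : E.j = 1728 := by
    rw [j, Units.val_inv_eq_inv_val, coe_Δ', hc4, ← mul_assoc, inv_mul_cancel₀ hΔ0, one_mul]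
  -- short Weierstrass form
  haveI : Invertible (2 : ZMod p) := invertibleOfNonzero h2
  haveI : Invertible (3 : ZMod p) := invertibleOfNonzero h3
  set C := E.toShortNF with hC
  have hj' : (C • E).j = 1728 := by rw [variableChange_j, hjE]
  have ha₆ : (C • E).a₆ = 0 := a₆_eq_zero_of_j_eq (C • E) h2 h3 hj'
  set D : ℤ := -(((C • E).a₄).val : ℤ) with hD
  have hDp : (D : ZMod p) = -(C • E).a₄ := by
    rw [hD]; push_cast; rw [ZMod.natCast_zmod_val]
  have hCE : C • E = ⟨0, 0, 0, -(D : ZMod p), 0⟩ := by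
    rw [hDp, neg_neg]
    ext
    · exact (C • E).a₁_of_isShortNF
    · exact (C • E).a₂_of_isShortNF
    · exact (C • E).a₃_of_isShortNF
    · rfl
    · exact ha₆
  have ha₄ : (C • E).a₄ ≠ 0 := by
    intro h0
    have : (C • E).Δ = 0 := by rw [(C • E).Δ_of_isShortNF, h0, ha₆]; ring
    exact (C • E).Δ'.ne_zero (by rw [coe_Δ']; exact this)
  refine ⟨D, ?_, ?_⟩
  · rw [← ZMod.intCast_zmod_eq_zero_iff_dvd, hDp, neg_eq_zero]
    exact ha₄
  · rw [reductionPointCount, ← hE, Nat.card_congr (VariableChange.pointEquiv E C).toEquiv, hCE]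

/-! ### The `j = 1728` case of Deuring's theorem -/

open QuadraticFields.GaussianPrimary GaussianQuartic in
/-- **Deuring's `a_p = π + π̄` for `j = 1728`, proved** (the body of
`Deuring1941_frobeniusTrace_eq_add_conj` under `W.j = 1728`; Cox, Thm. 14.16 with the remark
after (14.17) and Exercise 14.14 that this case is Gauss's; Ireland–Rosen, Ch. 18 §4 Thm. 5):
for a globally minimal `W/ℚ` with `j(W) = 1728`, an odd prime `p ∤ Δ_W` with `p ∤ -4` and `-4` a
square mod `p`, there is `π ∈ ℤ[ω_{-4}] = GaussianInt` with `ππ̄ = p` and `a_p(W) = π + π̄`. From the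
tree's `IrelandRosen1990_card_points_one_mod_four_holds` through
`exists_natCard_reduction_eq_of_j_eq`. [cite: IrelandRosen1990, Ch. 18 §4, Theorem 5 (PDF p. 301)]
[cite: Cox2013, Thm. 14.16 with (14.17) ff. and Exercise 14.14 (§14.C, PDF pp. 322–324, 337)] -/
theorem Deuring1941_frobeniusTrace_eq_add_conj_of_j_eq (W : WeierstrassCurve ℚ) [W.IsElliptic]
    [W.IsGloballyMinimal] (hj : W.j = 1728) (p : ℕ) (hp : p.Prime) (h2 : p ≠ 2)
    (hΔ : ¬ (p : ℤ) ∣ minimalDiscriminantInt W) (_hd : ¬ (p : ℤ) ∣ cmDiscr W.j)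
    (hsplit : IsSquare ((cmDiscr W.j : ℤ) : ZMod p)) :
    ∃ π : ℂ, π ∈ cmRing (cmDiscr W.j) ∧ π * conj π = p ∧
      (W.frobeniusTrace p : ℂ) = π + conj π := by
  haveI : Fact p.Prime := ⟨hp⟩
  have hd4 : cmDiscr W.j = -4 := by rw [hj]; norm_num [cmDiscr]
  rw [hd4] at hsplit ⊢
  have hp1 : p % 4 = 1 := mod_four_eq_one_of_isSquare_neg_four h2 hsplit
  have h2' : (2 : ZMod p) ≠ 0 := two_ne_zero_of_one_mod_four hp1
  have h3' : (3 : ZMod p) ≠ 0 := by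
    intro h0
    have h0' : ((3 : ℕ) : ZMod p) = 0 := by exact_mod_cast h0
    rw [ZMod.natCast_eq_zero_iff] at h0'
    have := Nat.le_of_dvd (by norm_num) h0'
    have := hp.two_le
    interval_cases p <;> omega
  -- the reduction is `y² = x³ - Dx`
  obtain ⟨D, hD, hcount⟩ := exists_natCard_reduction_eq_of_j_eq W hj h2' h3' hΔ
  -- a primary `π` of norm `p`
  obtain ⟨a, b, hab⟩ := Nat.Prime.sq_add_sq (p := p) (by omega)
  set π₀ : GaussianInt := ⟨a, b⟩ with hπ₀
  have hπ₀p : π₀.norm = p := by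
    rw [Zsqrtd.norm_def, hπ₀]; push_cast; rw [← hab]; push_cast; ring
  have hpar : (π₀.re + π₀.im) % 2 = 1 := by
    rw [← norm_emod_two, hπ₀p]; exact_mod_cast (show (p : ℤ) % 2 = 1 by omega)
  set π : GaussianInt := primary π₀ with hπ
  have hπP : IsPrimary π := isPrimary_primary hpar
  have hπp : π.norm = p := by rw [hπ, norm_primary hpar, hπ₀p]
  have hπ1 : (⟨2, 2⟩ : GaussianInt) ∣ π - 1 := (isPrimary_iff_dvd π).mp hπP
  -- `χ_π(D) = i^k`
  have hD0 : ((D : ℤ) : ZMod p) ≠ 0 := by rwa [Ne, ZMod.intCast_zmod_eq_zero_iff_dvd]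
  obtain ⟨k, hk⟩ : ∃ k : ℕ, chi hp1 hπp (D : ZMod p) = ⟨0, 1⟩ ^ k := by
    rcases eq_of_isUnit (isUnit_chi hp1 hπp hD0) with h | h | h | h
    · exact ⟨0, by rw [h, pow_zero]⟩
    · exact ⟨2, by rw [h]; decide⟩
    · exact ⟨1, by rw [h, pow_one]⟩
    · exact ⟨3, by rw [h]; decide⟩
  have hkdvd : π ∣ (D : GaussianInt) ^ ((p - 1) / 4) - ⟨0, 1⟩ ^ k := by
    apply dvd_of_red_eq_zero hπp
    have hred := (chi_eq_iff hp1 hπp hD0 (isUnit_I.pow k)).mp hk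
    rw [map_sub, map_pow, map_intCast, show (p - 1) / 4 = p / 4 by omega, ← hred, sub_self]
  -- Ireland–Rosen 18.5
  have hN := IrelandRosen1990_card_points_one_mod_four_holds hp1 hD hπp hπ1 hkdvd
  rw [← hcount] at hN
  -- `π' = conj(i^k) π`
  set π' : GaussianInt := star ((⟨0, 1⟩ : GaussianInt) ^ k) * π with hπ'
  have hu : IsUnit (star ((⟨0, 1⟩ : GaussianInt) ^ k)) := (isUnit_I.pow k).star
  have hπ'p : π'.norm = p := by
    rw [hπ', Zsqrtd.norm_mul, (Zsqrtd.norm_eq_one_iff' (by norm_num) _).mpr hu, one_mul, hπp]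
  refine ⟨(π' : ℂ), toComplex_mem_cmRing_neg_four π', ?_, ?_⟩
  · rw [Complex.mul_conj, ← GaussianInt.intCast_complex_norm, hπ'p, Int.cast_natCast]
  · have hft : W.frobeniusTrace p = 2 * π'.re := by
      rw [frobeniusTrace]
      linear_combination (-1 : ℤ) * hN
    rw [hft, Complex.add_conj, ← GaussianInt.intCast_re]
    push_cast
    ring

end Literature.NumberTheory.EllipticCurves
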